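import Summits.NavierStokesRegularity.NavierStokesRegularity.Theorems.LerayQuarterDissipationFiniteDissipationLiouvilleEnvelope
import Summits.NavierStokesRegularity.NavierStokesRegularity.Theorems.LerayQuarterDissipationFiniteDissipationLiouvilleHardness
import HarnessLib

/-!
# Crux `FiniteDissipationLiouville` (stmt-NavierStokesRegularity-22144) IS the Liouville problem for
# Type-I ancient mild fields with the SPACE-TIME envelope — the dissipation law drops out

Theorems file of route `LerayQuarterDissipation` (seat ns-lqd-p2 g7; `--supports` the crux).
Navier–Stokes regularity is NOT proved by anything here; both sides of the equivalence stay OPEN.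

* `finiteDissipationLiouville_iff_envelopeLiouville` —
  `FiniteDissipationLiouville ⟺ (∀ C A w, IsTypeIAncientMild C w → HasTypeIDecay A w → w is
  bounded on some backward cylinder at the origin)`.
  Forward: the envelope class lies in the stratum (`Hardness.exists_dissipationLaw_of_hasTypeIDecay`,
  ns-lqd-p1 p588754: the space–time envelope forces the quarter-rate dissipation law). Backward:
  `Envelope.finiteDissipationLiouville_of_envelopeLiouville` (this seat: a counterexample to the crux
  yields a CRITICAL ELEMENT, and critical elements carry the envelope `‖W‖ ≤ A/(‖x‖ + √(−t))`).

So the crux of route `LerayQuarterDissipation` — stated for the finite-dissipation strata `𝒟_{C,K}`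
— is EXACTLY the classical Liouville problem for ancient mild solutions that are Type I in space AND
time (Koch–Nadirashvili–Seregin–Šverák 2009 / Seregin–Šverák 2009, the class in which Chae–Wolf 2017
and Pineau–Vicol 2026 work); the dissipation hypothesis carries no extra difficulty and no extra help.

References: Koch–Nadirashvili–Seregin–Šverák, Acta Math. 203 (2009), §1, §4; Seregin–Šverák,
Comm. PDE 34 (2009); Chae–Wolf, arXiv:1610.09464.
-/

noncomputable section

-- the summit and its single sub-problem share the name (CONVENTIONS §1), as in every Theorems file
set_option linter.dupNamespace false

namespace Summit.NavierStokesRegularity.NavierStokesRegularity.Theorems.FiniteDissipationLiouville.Envelope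

open MeasureTheory Set Filter Topology Metric Function
open Literature.Analysis Literature.Analysis.FluidPDE
open Summit.NavierStokesRegularity.NavierStokesRegularity.Theorems.FiniteDissipationLiouville
open scoped ENNReal NNReal

/-- **`FiniteDissipationLiouville` ⟺ the envelope-class Liouville statement.** The crux holds iff
every Type-I ancient mild field (KNSS gauge, any constant) with the space–time Type-I envelope
`HasTypeIDecay A` (any `A`) is bounded on some backward cylinder `(−r², 0) × B(0, r)`
(forward by `Hardness.exists_dissipationLaw_of_hasTypeIDecay`; backward by
`finiteDissipationLiouville_of_envelopeLiouville`). [cite: KochNadirashviliSereginSverak2009, §1 and §4 (arXiv:0709.3599)] -/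
theorem finiteDissipationLiouville_iff_envelopeLiouville :
    Summit.NavierStokesRegularity.NavierStokesRegularity.Theses.LerayQuarterDissipation.FiniteDissipationLiouville ↔
      ∀ (C A : ℝ) (w : ℝ → EuclideanSpace ℝ (Fin 3) → EuclideanSpace ℝ (Fin 3)),
        IsTypeIAncientMild C w → HasTypeIDecay A w →
        ¬ (∀ r > 0, ∀ M : ℝ, ∃ t ∈ Ioo (-(r ^ 2)) (0 : ℝ),
          ∃ x ∈ ball (0 : EuclideanSpace ℝ (Fin 3)) r, M < ‖w t x‖) := by
  unfold Summit.NavierStokesRegularity.NavierStokesRegularity.Theses.LerayQuarterDissipation.FiniteDissipationLiouville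
  constructor
  · intro h C A w hw hdec
    obtain ⟨K', hlaw⟩ := Hardness.exists_dissipationLaw_of_hasTypeIDecay hw hdec
    exact h C K' w hw hlaw
  · intro h
    exact finiteDissipationLiouville_of_envelopeLiouville fun C A K w hw hdec _ => h C A w hw hdec

end Summit.NavierStokesRegularity.NavierStokesRegularity.Theorems.FiniteDissipationLiouville.Envelope

end
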